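import Summits.QuantumFields.BalabanUV.T4Continuum.Support.RegionGaugeCheckerboardTower

/-!
# `BalabanUV.T4Continuum.Support.RegionGaugeContactNoGo` — NE2 (node U1a) formalisation swarm, SUPPLIER item «Δ1-COERC-ORTH-LINE» under the
# owner's sub-row `T4-U1a.S-NE2-D1-DIRICHLET°` (vector layer W1), FINDING F-ne2leaf09g9-1 GENERALISED: THE LEVEL-UNIFORM W1 BINDER IS
# UNSATISFIABLE ON EVERY BLOCK REGION CONTAINING A DIAGONAL CONTACT OF AN ISOLATED EXTERIOR BLOCK (unit b2b-balaban-t4-ne2-formalise-leaf-09,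
# gen 9, v1)

HONEST FRAMING (T4-DAG p. 1).  [folklore] `U = 1`, the faithful single-scale star-bond region operator, ONE arbitrary block region `S`
carrying the LOCAL configuration `IsContact S w e ν`: the blocks `w` and `w′ = w + e + e_ν` are EXTERIOR (`¬ S w`, `¬ S w′`) and all `2d` face
neighbours `w′ ± e_ρ` of `w′` are in `S` (so `w′` is an isolated exterior block touching the exterior block `w` along a codimension-2 face
only).  The checkerboard files (`RegionGaugeCheckerboard{Field,Paths,NoGo,Tower}`, `S✗ = T ∖ {w, w′}`) are the minimal instance; THIS file
transfers their capacity bound to every such `S` by ZERO-EXTENSION OF THE GAUGE: a Dirichlet gauge `μ` on `Ω(S) ⊆ Ω(S✗)` extends by `0` to a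
Dirichlet gauge on `Ω(S✗)`, and the two residual fields `∂(1_{w′} − ext μ)` coincide bond by bond (on the extra star bonds of `S✗` both
endpoints are `S`-exterior, `ext μ = 0` there, and `1_{w′}` takes equal values because `w′`'s neighbours are in `S`).  Hence
`c·H_n ≤ 6·d·a` for every slice constant on `S`, and the tower socket `∀ k, SliceCoercive (… lev L k …) c` is uninhabited on `S`.
Owner R31 (b) ∕ R32 (b) (journal l.20053 ∕ l.20841): «FALSE with one constant on unions with codimension-2 exterior contacts» — this file
is the kernel form of that sentence for ISOLATED contacts (general face-components of the exterior: NOT treated).  Nothing printed is a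
hypothesis; NE2 (U1a) NOT proved; spine PROVED 0/9 unchanged; NOT [B9] (3.23)–(3.27) as printed (nothing about the printed regions with their
collars (3.16)); NOT infinite volume, NOT the mass gap, NOT Clay.  HONEST DEPENDENCY (verbatim): «continuum YM on T⁴ ⇐ BetaPertH ∧ nine spine
estimates (0/9 proved); BetaPertH ⇐ (D1) ∧ (D4) ∧ CAP+tail; G-an2-4 gates asym, D1 and NE2/3/4.»

WHAT THIS FILE PROVES (0 sorry):
 * §1 `IsContact` (a hypothesis STRUCTURE on the block set, like `IsEThin`; not a fact) and its bookkeeping: `S ≤ S✗` block- and star-wise,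
   `blockInd_eq_of_not_starS` (the indicator of `w′` is constant across every non-star bond of `S`);
 * §2 the test field on the star bonds of `S`: `ext_testFieldS = ∂1_{w′}`, **`curlR_testFieldS = 0`**, `avgR_testFieldS = ∂₁1_{w′}`,
   **`mass_testFieldS_le : n^d·nsq (avgR A) ≤ 2d·n^d`**;
 * §3 ZERO-EXTENSION OF THE GAUGE `liftGauge`, the residual identity `ext_residual_eq`, and the transferred CAPACITY BOUND
   **`nsq_sub_gradR_testFieldS_ge : n^d·H_n/3 ≤ nsq (A − gradR n M S μ)`** for EVERY Dirichlet gauge `μ` on `Ω(S)`;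
 * §4 ENDs **`sliceCoercive_contact_le : IsContact M S w e ν → SliceCoercive (curlR n M S) (gradR n M S) (GOm n M a′ S) (QOm n M S) (avgR n M S)
   (a·n^d) c → 0 ≤ c → c·H_n ≤ 6·d·a`** (`e ≠ ν`, `2 ≤ M e`, `2 ≤ M ν`, `0 ≤ a`, `0 < a′`), **`not_sliceCoercive_tower_contact`** (`2 ≤ L`,
   `0 < c`: `¬ ∀ k, SliceCoercive (… lev L k …) c`), `sliceCoercive_lev_contact_le : c_k·H_{k+1} ≤ 6da`;
 * §5 non-vacuity: `isContact_compl` (the complement of ANY finite exterior set containing the pair with `w′` isolated in it) and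
   `isContact_checker` (`S✗` itself, `2 ≤ M ρ` for all `ρ`).

ABSOLUTE RULE (cell, verbatim): «No internally-minted statement may enter as a cited fact. Every hypothesis is either kernel-proved in
this package or a verbatim quotation of a PUBLISHED theorem with page reference. The manuscript(s) under audit are NOT citable for
their own disputed steps — they are the thing under adjudication; programme-internal (2001/route/tribunal) claims are never citable.»
[folklore] throughout; ONE hypothesis structure `IsContact`, two data defs (`testFieldS`, `liftGauge`); no `def … : Prop` fact.  NOT CLAIMED:
contacts between non-isolated exterior components; the lower bound `c_k ≳ 1/k`; anything positive about W1; NE2; NE3.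
-/

noncomputable section

open scoped BigOperators ComplexConjugate Matrix
open Finset

namespace Summit.QuantumFields.BalabanUV.T4Continuum.RegionGaugeContactNoGo

open Literature.MathematicalPhysics.QuantumFieldTheory.Balaban1983to89.B5Prop11Plancherel (Tor fine unitVec)
open Literature.MathematicalPhysics.QuantumFieldTheory.Balaban1983to89.B5Prop11Lower (nsq nsq_nonneg)
open Literature.MathematicalPhysics.QuantumFieldTheory.Balaban1983to89.B5Action121 (GradOp GradOp_mulVec sdiff_mulVec CurlOp)
open Literature.MathematicalPhysics.QuantumFieldTheory.Balaban1983to89.B5Blocks16 (blockOf)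
open Literature.MathematicalPhysics.QuantumFieldTheory.Balaban1983to89.B5Hk160Torus (QvOp_GradOp_mulVec)
open Literature.MathematicalPhysics.QuantumFieldTheory.Balaban1983to89.B5G183RateUnitTower (lev)
open Summit.QuantumFields.BalabanUV.T4Continuum
open Summit.QuantumFields.BalabanUV.T4Continuum.SubtypeCompression (ext ext_apply_of ext_apply_of_not nsq_ext)
open Summit.QuantumFields.BalabanUV.T4Continuum.RegionScalarCompression (QOm GOm)
open Summit.QuantumFields.BalabanUV.T4Continuum.RegionGaugeFixedVector (starReg curlR gradR avgR CurlOp_mulVec_GradOp)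
open Summit.QuantumFields.BalabanUV.T4Continuum.RegionGaugeFixedVectorFlat (submatrix_mulVec_eq avgR_mulVec blockOf_add_unitVec)
open Summit.QuantumFields.BalabanUV.T4Continuum.RegionGaugeSlice (SliceCoercive)
open Summit.QuantumFields.BalabanUV.T4Continuum.RegionGaugeSliceOrthRegion (orthSlice_region_of_sliceCoercive)
open Summit.QuantumFields.BalabanUV.T4Continuum.RegionGaugeOrbit (gaugePoincare_of_orthSlice)
open Summit.QuantumFields.BalabanUV.T4Continuum.RegionGaugeCheckerboardField
  (wp checker blockInd testField one_ne_zero_of_two_le wp_add_ne_w QsOp_blockInd nsq_grad_indicator_le sub_gradR_eq)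
open Summit.QuantumFields.BalabanUV.T4Continuum.RegionGaugeCheckerboardNoGo (harm harm_unbounded nsq_sub_gradR_testField_ge)
open Summit.QuantumFields.BalabanUV.T4Continuum.RegionGaugeCheckerboardTower (succ_le_lev harm_mono)
open Summit.QuantumFields.BalabanUV.Beta.GAN24.DirichletBoxCompression (toBlock_mulVec')
open Summit.QuantumFields.BalabanUV.Beta.GAN24.DirichletBoxTrace (blockReg)

variable {d : ℕ} (n : ℕ) [NeZero n] (M : Fin d → ℕ) [hM : ∀ μ, NeZero (M μ)] (S : Tor M → Prop) [DecidablePred S] (w : Tor M) (e ν : Fin d)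

/-! ## §1 The local configuration -/

/-- [shape] **A DIAGONAL CONTACT OF AN ISOLATED EXTERIOR BLOCK** (hypothesis structure on the block set `S`, like `IsEThin`; not a fact): `w` and `w′ = w + e + e_ν` are exterior
and every face neighbour `w′ ± e_ρ` of `w′` belongs to `S`. [folklore] -/
structure IsContact (S : Tor M → Prop) (w : Tor M) (e ν : Fin d) : Prop where
  /-- `w` is exterior -/
  notw : ¬ S w
  /-- `w′` is exterior -/
  notwp : ¬ S (wp M w e ν)
  /-- the forward face neighbours of `w′` are in `S` -/
  nb_add : ∀ ρ : Fin d, S (wp M w e ν + unitVec M ρ)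
  /-- the backward face neighbours of `w′` are in `S` -/
  nb_sub : ∀ ρ : Fin d, S (wp M w e ν - unitVec M ρ)

variable {M S w e ν}

omit [NeZero n] hM [DecidablePred S] in
/-- `S ≤ S✗`: every block of `S` is a checkerboard block. [folklore] -/
theorem checker_of_mem (h : IsContact M S w e ν) {y : Tor M} (hy : S y) : checker M w e ν y :=
  ⟨fun h1 => h.notw (h1 ▸ hy), fun h2 => h.notwp (h2 ▸ hy)⟩

omit [DecidablePred S] in
/-- block-wise: `Ω(S) ⊆ Ω(S✗)`. [folklore] -/
theorem blockReg_checker_of (h : IsContact M S w e ν) {x : Tor (fine n M)} (hx : blockReg n M S x) :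
    blockReg n M (checker M w e ν) x :=
  checker_of_mem h hx

omit [DecidablePred S] in
/-- star-wise: `star(S) ⊆ star(S✗)`. [folklore] -/
theorem starReg_checker_of (h : IsContact M S w e ν) {b : Tor (fine n M) × Fin d} (hb : starReg n M S b) :
    starReg n M (checker M w e ν) b :=
  hb.imp (blockReg_checker_of n h) (blockReg_checker_of n h)

omit [DecidablePred S] in
/-- **THE INDICATOR OF `w′` IS CONSTANT ACROSS EVERY NON-STAR BOND OF `S`**: if both endpoints of a bond are `S`-exterior, neither lies in
`w′` unless both do (the face neighbours of `w′` are in `S`). [folklore] -/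
theorem blockInd_eq_of_not_starS (h : IsContact M S w e ν) {x : Tor (fine n M)} {μ : Fin d}
    (hx : ¬ blockReg n M S x) (hx' : ¬ blockReg n M S (x + unitVec (fine n M) μ)) :
    blockInd n M w e ν (x + unitVec (fine n M) μ) = blockInd n M w e ν x := by
  rcases blockOf_add_unitVec n M x μ with h0 | h0
  · simp only [blockInd, h0]
  · by_cases hz : blockOf n M x = wp M w e ν
    · refine absurd ?_ hx'
      show S (blockOf n M (x + unitVec (fine n M) μ))
      rw [h0, hz]; exact h.nb_add μ
    · by_cases hz' : blockOf n M (x + unitVec (fine n M) μ) = wp M w e ν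
      · refine absurd ?_ hx
        have : blockOf n M x = wp M w e ν - unitVec M μ := by rw [← hz', h0, add_sub_cancel_right]
        show S (blockOf n M x)
        rw [this]; exact h.nb_sub μ
      · simp only [blockInd, hz, hz', if_false]

/-! ## §2 The test field on the star bonds of `S` -/

variable (M S w e ν)

/-- **THE TEST FIELD** `A = ∂(1_{w′})` read on the star bonds of `Ω(S)`. [folklore] -/
def testFieldS : {b // starReg n M S b} → ℂ := fun b => (GradOp (fine n M) (n : ℂ) *ᵥ blockInd n M w e ν) b.1

variable {M S w e ν}

/-- its zero-extension is the full gradient: `ext A = ∂(1_{w′})`. [folklore] -/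
theorem ext_testFieldS (h : IsContact M S w e ν) :
    ext (starReg n M S) (testFieldS n M S w e ν) = GradOp (fine n M) (n : ℂ) *ᵥ blockInd n M w e ν := by
  funext b
  by_cases hb : starReg n M S b
  · exact ext_apply_of (starReg n M S) (testFieldS n M S w e ν) ⟨b, hb⟩
  · obtain ⟨x, μ⟩ := b
    have h1 : ¬ blockReg n M S x := fun h' => hb (Or.inl h')
    have h2 : ¬ blockReg n M S (x + unitVec (fine n M) μ) := fun h' => hb (Or.inr h')
    rw [ext_apply_of_not _ _ hb, GradOp_mulVec, sdiff_mulVec, blockInd_eq_of_not_starS n h h1 h2, sub_self, mul_zero]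

/-- **THE TEST FIELD IS CURL-FREE ON `Ω(S)`**: `curlR A = 0`. [folklore] -/
theorem curlR_testFieldS (h : IsContact M S w e ν) : curlR n M S *ᵥ testFieldS n M S w e ν = 0 := by
  rw [curlR, Matrix.smul_mulVec, submatrix_mulVec_eq, ext_testFieldS n h, CurlOp_mulVec_GradOp, smul_zero]

/-- its block averages: `avgR A = ∂₁ 1_{w′}`. [folklore] -/
theorem avgR_testFieldS (h : IsContact M S w e ν) :
    avgR n M S *ᵥ testFieldS n M S w e ν = GradOp M 1 *ᵥ (fun y => if y = wp M w e ν then (1 : ℂ) else 0) := by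
  rw [avgR_mulVec, ext_testFieldS n h, QvOp_GradOp_mulVec, QsOp_blockInd]

/-- **THE MASS TERM**: `n^d·nsq (avgR A) ≤ 2d·n^d`. [folklore] -/
theorem mass_testFieldS_le (h : IsContact M S w e ν) :
    (n : ℝ) ^ d * nsq (avgR n M S *ᵥ testFieldS n M S w e ν) ≤ 2 * d * (n : ℝ) ^ d := by
  rw [avgR_testFieldS n h, mul_comm]
  exact mul_le_mul_of_nonneg_right (nsq_grad_indicator_le _) (by positivity)

/-! ## §3 Zero-extension of the gauge and the transferred capacity bound -/

/-- **ZERO-EXTENSION OF A DIRICHLET GAUGE** from `Ω(S)` to `Ω(S✗)`. [folklore] -/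
def liftGauge (μ : {x // blockReg n M S x} → ℂ) : {x // blockReg n M (checker M w e ν) x} → ℂ :=
  fun x => ext (blockReg n M S) μ x.1

/-- the two zero-extensions agree as fine fields. [folklore] -/
theorem ext_liftGauge (h : IsContact M S w e ν) (μ : {x // blockReg n M S x} → ℂ) :
    ext (blockReg n M (checker M w e ν)) (liftGauge n (w := w) (e := e) (ν := ν) μ) = ext (blockReg n M S) μ := by
  funext x
  by_cases hc : blockReg n M (checker M w e ν) x
  · exact ext_apply_of (blockReg n M (checker M w e ν)) (liftGauge n μ) ⟨x, hc⟩
  · have hs : ¬ blockReg n M S x := fun h' => hc (blockReg_checker_of n h h')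
    rw [ext_apply_of_not _ _ hc, ext_apply_of_not _ _ hs]

/-- the residual of a Dirichlet gauge on `Ω(S)` is `∂(1_{w′} − ext μ)` on the star bonds. [folklore] -/
theorem sub_gradR_eqS (μ : {x // blockReg n M S x} → ℂ) (b : {b // starReg n M S b}) :
    (testFieldS n M S w e ν - gradR n M S *ᵥ μ) b = (GradOp (fine n M) (n : ℂ) *ᵥ (blockInd n M w e ν - ext (blockReg n M S) μ)) b.1 := by
  rw [Pi.sub_apply, testFieldS, gradR, toBlock_mulVec', Matrix.mulVec_sub, Pi.sub_apply]

/-- **THE RESIDUAL IDENTITY**: bond by bond, the zero-extended residual of `μ` on `Ω(S)` equals the zero-extended residual of its lift on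
`Ω(S✗)` — on the extra star bonds of `S✗` both endpoints are `S`-exterior, `ext μ` vanishes and `1_{w′}` is constant. [folklore] -/
theorem ext_residual_eq (h : IsContact M S w e ν) (μ : {x // blockReg n M S x} → ℂ) :
    ext (starReg n M S) (testFieldS n M S w e ν - gradR n M S *ᵥ μ)
      = ext (starReg n M (checker M w e ν)) (testField n M w e ν - gradR n M (checker M w e ν) *ᵥ liftGauge n μ) := by
  funext b
  by_cases hS : starReg n M S b
  · have hC : starReg n M (checker M w e ν) b := starReg_checker_of n h hS
    rw [show ext (starReg n M S) (testFieldS n M S w e ν - gradR n M S *ᵥ μ) b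
        = (testFieldS n M S w e ν - gradR n M S *ᵥ μ) ⟨b, hS⟩ from ext_apply_of _ _ ⟨b, hS⟩,
      show ext (starReg n M (checker M w e ν)) (testField n M w e ν - gradR n M (checker M w e ν) *ᵥ liftGauge n μ) b
        = (testField n M w e ν - gradR n M (checker M w e ν) *ᵥ liftGauge n μ) ⟨b, hC⟩ from ext_apply_of _ _ ⟨b, hC⟩,
      sub_gradR_eqS, sub_gradR_eq, ext_liftGauge n h]
  · rw [ext_apply_of_not _ _ hS]
    by_cases hC : starReg n M (checker M w e ν) b
    · rw [show ext (starReg n M (checker M w e ν)) (testField n M w e ν - gradR n M (checker M w e ν) *ᵥ liftGauge n μ) b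
          = (testField n M w e ν - gradR n M (checker M w e ν) *ᵥ liftGauge n μ) ⟨b, hC⟩ from ext_apply_of _ _ ⟨b, hC⟩,
        sub_gradR_eq, ext_liftGauge n h]
      obtain ⟨x, ρ⟩ := b
      have h1 : ¬ blockReg n M S x := fun h' => hS (Or.inl h')
      have h2 : ¬ blockReg n M S (x + unitVec (fine n M) ρ) := fun h' => hS (Or.inr h')
      rw [GradOp_mulVec, sdiff_mulVec, Pi.sub_apply, Pi.sub_apply, ext_apply_of_not _ _ h1, ext_apply_of_not _ _ h2,
        blockInd_eq_of_not_starS n h h1 h2, sub_self, mul_zero]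
    · rw [ext_apply_of_not _ _ hC]

/-- **THE TRANSFERRED CAPACITY BOUND**: for EVERY Dirichlet gauge `μ` on `Ω(S)`, `n^d·H_n/3 ≤ nsq (A − ∂_Ω μ)` (`e ≠ ν`, `2 ≤ M e`,
`2 ≤ M ν`) — the checkerboard bound `nsq_sub_gradR_testField_ge` read through the residual identity. [folklore] -/
theorem nsq_sub_gradR_testFieldS_ge (h : IsContact M S w e ν) (hMe : 2 ≤ M e) (hMν : 2 ≤ M ν) (hne : e ≠ ν)
    (μ : {x // blockReg n M S x} → ℂ) :
    (n : ℝ) ^ d * harm n / 3 ≤ nsq (testFieldS n M S w e ν - gradR n M S *ᵥ μ) := by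
  rw [← nsq_ext (starReg n M S), ext_residual_eq n h, nsq_ext]
  exact nsq_sub_gradR_testField_ge n M (liftGauge n μ) hMe hMν hne

/-! ## §4 The no-go on `S` -/

variable (S w e ν) (a a' : ℝ)

/-- **NO-GO FOR A LEVEL-UNIFORM SLICE CONSTANT AT A DIAGONAL CONTACT OF AN ISOLATED EXTERIOR BLOCK**: every slice constant `c ≥ 0` of the
faithful region operator on `Ω(S)` at level `n` obeys `c·H_n ≤ 6·d·a` (`0 ≤ a`, `0 < a′`, `e ≠ ν`, `2 ≤ M e`, `2 ≤ M ν`). [folklore] -/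
theorem sliceCoercive_contact_le (h : IsContact M S w e ν) (hMe : 2 ≤ M e) (hMν : 2 ≤ M ν) (hne : e ≠ ν) (ha : 0 ≤ a) (ha' : 0 < a')
    {c : ℝ} (hc : 0 ≤ c)
    (hS : SliceCoercive (curlR n M S) (gradR n M S) (GOm n M a' S) (QOm n M S) (avgR n M S) (a * (n : ℝ) ^ d) c) :
    c * harm n ≤ 6 * d * a := by
  have hn0 : (0 : ℝ) < (n : ℝ) ^ d := pow_pos (by exact_mod_cast Nat.pos_of_ne_zero (NeZero.ne n)) d
  have hO := orthSlice_region_of_sliceCoercive n M a a' S ha' hc hS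
  obtain ⟨μ, -, hμ⟩ := gaugePoincare_of_orthSlice n M a a' S ha' hO (testFieldS n M S w e ν)
  rw [curlR_testFieldS n h] at hμ
  have h0 : nsq (0 : Tor (fine n M) × (Fin d × Fin d) → ℂ) = 0 := by simp [nsq]
  rw [h0, zero_add] at hμ
  have hmass := mass_testFieldS_le n h
  have hcap := nsq_sub_gradR_testFieldS_ge n h hMe hMν hne μ
  have h1 : c * ((n : ℝ) ^ d * harm n / 3) ≤ a * (2 * d * (n : ℝ) ^ d) := by
    calc c * ((n : ℝ) ^ d * harm n / 3) ≤ c * nsq (testFieldS n M S w e ν - gradR n M S *ᵥ μ) := mul_le_mul_of_nonneg_left hcap hc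
      _ ≤ a * (n : ℝ) ^ d * nsq (avgR n M S *ᵥ testFieldS n M S w e ν) := hμ
      _ = a * ((n : ℝ) ^ d * nsq (avgR n M S *ᵥ testFieldS n M S w e ν)) := by ring
      _ ≤ a * (2 * d * (n : ℝ) ^ d) := mul_le_mul_of_nonneg_left hmass ha
  have h2 : c * harm n * (n : ℝ) ^ d ≤ 6 * d * a * (n : ℝ) ^ d := by nlinarith
  exact le_of_mul_le_mul_right h2 hn0

/-- per level of a tower: **`c_k · H_{k+1} ≤ 6·d·a`** (`2 ≤ L`, `n_k = L^k ≥ k+1`). [folklore] -/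
theorem sliceCoercive_lev_contact_le (L : ℕ) [NeZero L] (hL : 2 ≤ L) (h : IsContact M S w e ν) (hMe : 2 ≤ M e) (hMν : 2 ≤ M ν)
    (hne : e ≠ ν) (ha : 0 ≤ a) (ha' : 0 < a') (k : ℕ) {c : ℝ} (hc : 0 ≤ c)
    (hS : SliceCoercive (curlR (lev L k) M S) (gradR (lev L k) M S) (GOm (lev L k) M a' S) (QOm (lev L k) M S) (avgR (lev L k) M S)
      (a * ((lev L k : ℕ) : ℝ) ^ d) c) :
    c * harm (k + 1) ≤ 6 * d * a :=
  (mul_le_mul_of_nonneg_left (harm_mono (succ_le_lev L hL k)) hc).trans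
    (sliceCoercive_contact_le (lev L k) S w e ν a a' h hMe hMν hne ha ha' hc hS)

/-- **THE TOWER SOCKET IS UNINHABITED ON `S`**: for `2 ≤ L`, `0 ≤ a`, `0 < a′` and every `c > 0`, `¬ ∀ k, SliceCoercive (… lev L k …) c` —
the `hS` hypothesis of the star-bond tower ENDs cannot be supplied with one constant on any region with an isolated diagonal contact.
[folklore] -/
theorem not_sliceCoercive_tower_contact (L : ℕ) [NeZero L] (hL : 2 ≤ L) (h : IsContact M S w e ν) (hMe : 2 ≤ M e) (hMν : 2 ≤ M ν)
    (hne : e ≠ ν) (ha : 0 ≤ a) (ha' : 0 < a') {c : ℝ} (hc : 0 < c) :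
    ¬ ∀ k : ℕ, SliceCoercive (curlR (lev L k) M S) (gradR (lev L k) M S) (GOm (lev L k) M a' S) (QOm (lev L k) M S) (avgR (lev L k) M S)
      (a * ((lev L k : ℕ) : ℝ) ^ d) c := by
  intro hS
  obtain ⟨m, hm⟩ := harm_unbounded (6 * d * a / c)
  have hk := sliceCoercive_lev_contact_le S w e ν a a' L hL h hMe hMν hne ha ha' m hc.le (hS m)
  rw [div_lt_iff₀ hc] at hm
  linarith

/-! ## §5 Non-vacuity -/

variable {S w e ν}

omit [NeZero n] hM [DecidablePred S] in
/-- **THE COMPLEMENT OF ANY FINITE EXTERIOR SET CONTAINING THE PAIR, WITH `w′` ISOLATED IN IT, carries the contact.** [folklore] -/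
theorem isContact_compl (E : Finset (Tor M)) (hw : w ∈ E) (hwp : wp M w e ν ∈ E) (hadd : ∀ ρ : Fin d, wp M w e ν + unitVec M ρ ∉ E)
    (hsub : ∀ ρ : Fin d, wp M w e ν - unitVec M ρ ∉ E) : IsContact M (fun y => y ∉ E) w e ν :=
  ⟨fun h => h hw, fun h => h hwp, hadd, hsub⟩

omit [NeZero n] hM in
/-- a unit vector of a direction with `2 ≤ M ρ` is nonzero. [folklore] -/
theorem unitVec_ne_zero {ρ : Fin d} (hMρ : 2 ≤ M ρ) : unitVec M ρ ≠ 0 := by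
  intro h0
  have h1 := congrFun h0 ρ
  simp only [unitVec, Pi.single_eq_same, Pi.zero_apply] at h1
  exact one_ne_zero_of_two_le hMρ h1

omit [NeZero n] hM in
/-- `w′ − e_ρ ≠ w` (`2 ≤ M e`, `2 ≤ M ν`, `e ≠ ν`). [folklore] -/
theorem wp_sub_ne_w (hMe : 2 ≤ M e) (hMν : 2 ≤ M ν) (hne : e ≠ ν) (ρ : Fin d) : wp M w e ν - unitVec M ρ ≠ w := by
  intro h
  have h' : unitVec M e + unitVec M ν = unitVec M ρ := by
    rw [wp, sub_eq_iff_eq_add, add_assoc] at h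
    exact add_left_cancel h
  by_cases hρe : ρ = e
  · subst hρe
    have hν : unitVec M ν = 0 := by simpa using h'
    exact unitVec_ne_zero hMν hν
  · have hE := congrFun h' e
    simp only [Pi.add_apply, unitVec, Pi.single_eq_same, Pi.single_eq_of_ne hne, Pi.single_eq_of_ne (fun h'' => hρe h''.symm), add_zero] at hE
    exact one_ne_zero_of_two_le hMe hE

omit [NeZero n] hM in
/-- **THE CHECKERBOARD REGION `S✗ = T ∖ {w, w′}` carries the contact** (`2 ≤ M ρ` for every `ρ`, `e ≠ ν`). [folklore] -/
theorem isContact_checker (hM2 : ∀ ρ : Fin d, 2 ≤ M ρ) (hne : e ≠ ν) : IsContact M (checker M w e ν) w e ν where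
  notw := fun h => h.1 rfl
  notwp := fun h => h.2 rfl
  nb_add := fun ρ => ⟨wp_add_ne_w (hM2 e) (hM2 ν) hne ρ, fun h => unitVec_ne_zero (hM2 ρ) (by simpa using h)⟩
  nb_sub := fun ρ => ⟨wp_sub_ne_w (hM2 e) (hM2 ν) hne ρ, fun h => unitVec_ne_zero (hM2 ρ) (by simpa [sub_eq_self] using h)⟩

end Summit.QuantumFields.BalabanUV.T4Continuum.RegionGaugeContactNoGo

end
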